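import Summits.CriticalPhenomena.PercolationContinuityZ3.Theorems.PercNearOneGluingNoHeavyLowerTailCILRelayNeighbours
import Literature.Probability.Percolation.TwoClusterExchange
import HarnessLib

/-!
# `NoHeavyLowerTail` (stmt-CriticalPhenomena-4575) — separation stability of the lighter relay (BHK two-cluster exchange)

Support file (prover `prim-gen-induct`; `--supports stmt-CriticalPhenomena-4575`).  No definitions, no named facts, no sorries.

Steps 1–2 of the discharge of the port comparison (⋆) of `Theorems.cil_relayNeighbours_of_portComparison` (the companion
file `…CILRelayNeighboursHolds` does step 3 and concludes CIL for every observer adjacent only to relays):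

1. `CutObserver.hit_heavyLight_exchange` (‡): in ANY weighted graph, for vertices `i ≠ l`, a vertex set `W` and
   `T = {i ↔ W}`, `X = {M_i ≤ j < M_l}`, `Y = {M_l ≤ j < M_i}`:  `μ(T ∩ X)·μ(Y) ≤ μ(T ∩ Y)·μ(X)`.
   Both `X, Y` lie in `D = {i ↮ l}`, and this is two instances of the TWO-CLUSTER EXCHANGE inequality
   (`Literature.Probability.Percolation.twoClusterExchange` = van den Berg–Häggström–Kahn 2006 Thm 1.5): `T` and
   `{M_i > j} ∩ {M_l ≤ j}` are of type (+) (closed under enlarging `C_i`, shrinking `C_l`), `{M_i ≤ j} ∩ {M_l > j}` of type (−).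
2. `CutObserver.separation_stable` (†): if `μ{M_l ≤ j} ≤ μ{M_i ≤ j}` then `μ(i ↮ W, M_l ≤ j) ≤ μ(i ↮ W, M_i ≤ j)` for every `W`
   ("the lighter relay stays lighter when its cluster is kept away from any set `W`") — algebra from (‡).
3. Transfer to `H = G − o` (`prodBernoulli_map_inter`: `ω ↦ ω ∩ {e | o ∉ e}` pushes `μ_w` to the measure with the weights at `o`
   switched off) and induction over the later ports, integrating one port coin at a time, turn (†) into (⋆).

Numerics preceding the proof (this seat, exact partition DP): (‡) 196 500 tests, (†) pairwise 173 000 tests, 0 violations.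
-/

noncomputable section

namespace Summit.CriticalPhenomena.PercolationContinuityZ3.Theorems

open MeasureTheory Set Literature.Probability.LatticeModels Literature.Probability.Percolation
open scoped Classical BigOperators

variable {n : ℕ}

namespace CutObserver

/-! ### Step 1: the heavy/light exchange (‡) from BHK's two-cluster exchange -/

/-- Enlarging the open edge cluster of `s` enlarges the set of relays joined to `s`. [folklore] -/
theorem relayFilter_subset_of_openEdgeCluster_subset (A : Finset (Fin n)) (s : Fin n) {ω ω' : BondConfig (Fin n)}
    (h : openEdgeCluster ω s ⊆ openEdgeCluster ω' s) :
    (A.filter fun x => (openGraph ω).Reachable s x) ⊆ (A.filter fun x => (openGraph ω').Reachable s x) := by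
  intro x hx
  rw [Finset.mem_filter] at hx ⊢
  refine ⟨hx.1, ?_⟩
  rw [reachable_iff_exists_mem_openEdgeCluster] at hx ⊢
  rcases hx.2 with h1 | ⟨e, he, hxe⟩
  · exact Or.inl h1
  · exact Or.inr ⟨e, h he, hxe⟩

/-- **(‡) Heavy/light exchange.**  For vertices `i ≠ l`, a finite vertex set `W`, `T = {i ↔ some vertex of W}`,
`X = {M_i ≤ j < M_l}`, `Y = {M_l ≤ j < M_i}` (`M_v` = number of `A`-vertices joined to `v`):
`μ(T ∩ X)·μ(Y) ≤ μ(T ∩ Y)·μ(X)` — "touching `W` is likelier for a heavy `i` facing a light `l` than for a light `i` facing a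
heavy `l`".  Two applications of the two-cluster exchange inequality on `{i ↮ l} ⊇ X ∪ Y`.
[cite: VandenbergHaggstromKahn2005, Thm. 1.5 (p. 7) — via Literature.Probability.Percolation.twoClusterExchange] -/
theorem hit_heavyLight_exchange (u : Sym2 (Fin n) → unitInterval) (A : Finset (Fin n)) {i l : Fin n} (hil : i ≠ l)
    (W : Finset (Fin n)) (j : ℕ) :
    (prodBernoulli u).real ({ω : BondConfig (Fin n) | ∃ m ∈ W, (openGraph ω).Reachable i m} ∩
        {ω | (A.filter fun x => (openGraph ω).Reachable i x).card ≤ j ∧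
          j < (A.filter fun x => (openGraph ω).Reachable l x).card}) *
      (prodBernoulli u).real {ω : BondConfig (Fin n) |
        (A.filter fun x => (openGraph ω).Reachable l x).card ≤ j ∧
          j < (A.filter fun x => (openGraph ω).Reachable i x).card} ≤
    (prodBernoulli u).real ({ω : BondConfig (Fin n) | ∃ m ∈ W, (openGraph ω).Reachable i m} ∩
        {ω | (A.filter fun x => (openGraph ω).Reachable l x).card ≤ j ∧
          j < (A.filter fun x => (openGraph ω).Reachable i x).card}) *
      (prodBernoulli u).real {ω : BondConfig (Fin n) |
        (A.filter fun x => (openGraph ω).Reachable i x).card ≤ j ∧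
          j < (A.filter fun x => (openGraph ω).Reachable l x).card} := by
  haveI : IsProbabilityMeasure (prodBernoulli u) := inferInstance
  set Mi : BondConfig (Fin n) → ℕ := fun ω => (A.filter fun x => (openGraph ω).Reachable i x).card with hMi
  set Ml : BondConfig (Fin n) → ℕ := fun ω => (A.filter fun x => (openGraph ω).Reachable l x).card with hMl
  set T := {ω : BondConfig (Fin n) | ∃ m ∈ W, (openGraph ω).Reachable i m} with hT
  set P := {ω : BondConfig (Fin n) | j < Mi ω ∧ Ml ω ≤ j} with hP
  set Q := {ω : BondConfig (Fin n) | Mi ω ≤ j ∧ j < Ml ω} with hQ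
  set D := (openConn i l : Set (BondConfig (Fin n)))ᶜ with hD
  have hsame : ∀ ω : BondConfig (Fin n), (openGraph ω).Reachable i l → Mi ω = Ml ω := by
    intro ω h
    simp only [hMi, hMl]
    congr 1
    exact Finset.filter_congr fun x _ => ⟨fun hx => h.symm.trans hx, fun hx => h.trans hx⟩
  have hPD : P ⊆ D := by
    intro ω hω hil'
    have := hsame ω hil'
    simp only [hP, mem_setOf_eq] at hω
    omega
  have hQD : Q ⊆ D := by
    intro ω hω hil'
    have := hsame ω hil'
    simp only [hQ, mem_setOf_eq] at hω
    omega
  have hT_plus : ∀ ⦃ω ω' : BondConfig (Fin n)⦄, openEdgeCluster ω i ⊆ openEdgeCluster ω' i →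
      openEdgeCluster ω' l ⊆ openEdgeCluster ω l → ω ∈ T → ω' ∈ T := by
    intro ω ω' hs ht hω
    obtain ⟨m, hm, hreach⟩ := hω
    exact ⟨m, hm, typePlus_openConn i l m hs ht hreach⟩
  have hP_plus : ∀ ⦃ω ω' : BondConfig (Fin n)⦄, openEdgeCluster ω i ⊆ openEdgeCluster ω' i →
      openEdgeCluster ω' l ⊆ openEdgeCluster ω l → ω ∈ P → ω' ∈ P := by
    intro ω ω' hs ht hω
    simp only [hP, mem_setOf_eq, hMi, hMl] at hω ⊢
    have h1 := Finset.card_le_card (relayFilter_subset_of_openEdgeCluster_subset A i hs)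
    have h2 := Finset.card_le_card (relayFilter_subset_of_openEdgeCluster_subset A l ht)
    omega
  have hQ_minus : ∀ ⦃ω ω' : BondConfig (Fin n)⦄, openEdgeCluster ω' i ⊆ openEdgeCluster ω i →
      openEdgeCluster ω l ⊆ openEdgeCluster ω' l → ω ∈ Q → ω' ∈ Q := by
    intro ω ω' hs ht hω
    simp only [hQ, mem_setOf_eq, hMi, hMl] at hω ⊢
    have h1 := Finset.card_le_card (relayFilter_subset_of_openEdgeCluster_subset A i hs)
    have h2 := Finset.card_le_card (relayFilter_subset_of_openEdgeCluster_subset A l ht)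
    omega
  have triv_plus : ∀ ⦃ω ω' : BondConfig (Fin n)⦄, openEdgeCluster ω i ⊆ openEdgeCluster ω' i →
      openEdgeCluster ω' l ⊆ openEdgeCluster ω l → ω ∈ (univ : Set (BondConfig (Fin n))) →
      ω' ∈ (univ : Set (BondConfig (Fin n))) :=
    fun _ _ _ _ _ => mem_univ _
  have triv_minus : ∀ ⦃ω ω' : BondConfig (Fin n)⦄, openEdgeCluster ω' i ⊆ openEdgeCluster ω i →
      openEdgeCluster ω l ⊆ openEdgeCluster ω' l → ω ∈ (univ : Set (BondConfig (Fin n))) →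
      ω' ∈ (univ : Set (BondConfig (Fin n))) :=
    fun _ _ _ _ _ => mem_univ _
  -- (i)  μ(D∩T)·μ(D∩P) ≤ μ(D∩(T∩P))·μ(D)
  have hi := twoClusterExchange u hil (A₁ := T) (A₂ := P) (B₁ := univ) (B₂ := univ)
    hT_plus hP_plus triv_minus triv_minus
  -- (ii) μ(D∩(T∩Q))·μ(D) ≤ μ(D∩T)·μ(D∩Q)
  have hii := twoClusterExchange u hil (A₁ := T) (A₂ := univ) (B₁ := Q) (B₂ := univ)
    hT_plus triv_plus hQ_minus triv_minus
  simp only [inter_univ] at hi hii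
  have e1 : (prodBernoulli u).real (T ∩ Q) = (prodBernoulli u).real (D ∩ (T ∩ Q)) := by
    congr 1; ext ω; exact ⟨fun h => ⟨hQD h.2, h⟩, fun h => h.2⟩
  have e2 : (prodBernoulli u).real P = (prodBernoulli u).real (D ∩ P) := by
    congr 1; ext ω; exact ⟨fun h => ⟨hPD h, h⟩, fun h => h.2⟩
  have e3 : (prodBernoulli u).real (T ∩ P) = (prodBernoulli u).real (D ∩ (T ∩ P)) := by
    congr 1; ext ω; exact ⟨fun h => ⟨hPD h.2, h⟩, fun h => h.2⟩
  have e4 : (prodBernoulli u).real Q = (prodBernoulli u).real (D ∩ Q) := by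
    congr 1; ext ω; exact ⟨fun h => ⟨hQD h, h⟩, fun h => h.2⟩
  have hYP : {ω : BondConfig (Fin n) | Ml ω ≤ j ∧ j < Mi ω} = P := by
    ext ω; simp only [hP, mem_setOf_eq]; tauto
  show (prodBernoulli u).real (T ∩ {ω | Mi ω ≤ j ∧ j < Ml ω}) *
      (prodBernoulli u).real {ω | Ml ω ≤ j ∧ j < Mi ω} ≤
    (prodBernoulli u).real (T ∩ {ω | Ml ω ≤ j ∧ j < Mi ω}) *
      (prodBernoulli u).real {ω | Mi ω ≤ j ∧ j < Ml ω}
  rw [hYP]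
  change (prodBernoulli u).real (T ∩ Q) * (prodBernoulli u).real P ≤
    (prodBernoulli u).real (T ∩ P) * (prodBernoulli u).real Q
  rw [e1, e2, e3, e4]
  have hD0 : 0 ≤ (prodBernoulli u).real D := measureReal_nonneg
  have hTP0 : 0 ≤ (prodBernoulli u).real (D ∩ (T ∩ P)) := measureReal_nonneg
  have hTQ0 : 0 ≤ (prodBernoulli u).real (D ∩ (T ∩ Q)) := measureReal_nonneg
  have hQ0 : 0 ≤ (prodBernoulli u).real (D ∩ Q) := measureReal_nonneg
  have hP0 : 0 ≤ (prodBernoulli u).real (D ∩ P) := measureReal_nonneg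
  have hT0 : 0 ≤ (prodBernoulli u).real (D ∩ T) := measureReal_nonneg
  by_cases hDz : (prodBernoulli u).real D = 0
  · have hz1 : (prodBernoulli u).real (D ∩ (T ∩ Q)) = 0 :=
      le_antisymm (le_trans (measureReal_mono inter_subset_left (measure_ne_top _ _)) (le_of_eq hDz))
        measureReal_nonneg
    rw [hz1, zero_mul]
    exact mul_nonneg hTP0 hQ0
  · have hDpos : 0 < (prodBernoulli u).real D := lt_of_le_of_ne hD0 (Ne.symm hDz)
    have step1 : (prodBernoulli u).real D * ((prodBernoulli u).real (D ∩ (T ∩ Q)) * (prodBernoulli u).real (D ∩ P)) ≤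
        (prodBernoulli u).real (D ∩ T) * (prodBernoulli u).real (D ∩ Q) * (prodBernoulli u).real (D ∩ P) := by
      have := mul_le_mul_of_nonneg_right hii hP0
      linarith
    have step2 : (prodBernoulli u).real (D ∩ T) * (prodBernoulli u).real (D ∩ Q) * (prodBernoulli u).real (D ∩ P) ≤
        (prodBernoulli u).real D * ((prodBernoulli u).real (D ∩ (T ∩ P)) * (prodBernoulli u).real (D ∩ Q)) := by
      have := mul_le_mul_of_nonneg_right hi hQ0
      linarith
    exact le_of_mul_le_mul_left (step1.trans step2) hDpos

/-! ### Step 2: separation stability (†) -/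

/-- **(†) The lighter relay stays lighter under separation.**  If `μ{M_l ≤ j} ≤ μ{M_i ≤ j}` (`i ≠ l`) then for every finite
vertex set `W`: `μ(i ↮ W, M_l ≤ j) ≤ μ(i ↮ W, M_i ≤ j)`. [folklore] -/
theorem separation_stable (u : Sym2 (Fin n) → unitInterval) (A : Finset (Fin n)) {i l : Fin n} (hil : i ≠ l)
    (W : Finset (Fin n)) (j : ℕ)
    (hs : (prodBernoulli u).real {ω : BondConfig (Fin n) | (A.filter fun x => (openGraph ω).Reachable l x).card ≤ j} ≤
      (prodBernoulli u).real {ω : BondConfig (Fin n) | (A.filter fun x => (openGraph ω).Reachable i x).card ≤ j}) :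
    (prodBernoulli u).real ({ω : BondConfig (Fin n) | ∀ m ∈ W, ¬ (openGraph ω).Reachable i m} ∩
        {ω | (A.filter fun x => (openGraph ω).Reachable l x).card ≤ j}) ≤
      (prodBernoulli u).real ({ω : BondConfig (Fin n) | ∀ m ∈ W, ¬ (openGraph ω).Reachable i m} ∩
        {ω | (A.filter fun x => (openGraph ω).Reachable i x).card ≤ j}) := by
  haveI : IsProbabilityMeasure (prodBernoulli u) := inferInstance
  set Mi : BondConfig (Fin n) → ℕ := fun ω => (A.filter fun x => (openGraph ω).Reachable i x).card with hMi
  set Ml : BondConfig (Fin n) → ℕ := fun ω => (A.filter fun x => (openGraph ω).Reachable l x).card with hMl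
  set T := {ω : BondConfig (Fin n) | ∃ m ∈ W, (openGraph ω).Reachable i m} with hT
  set X := {ω : BondConfig (Fin n) | Mi ω ≤ j ∧ j < Ml ω} with hX
  set Y := {ω : BondConfig (Fin n) | Ml ω ≤ j ∧ j < Mi ω} with hY
  have hdd := hit_heavyLight_exchange u A hil W j
  change (prodBernoulli u).real (T ∩ X) * (prodBernoulli u).real Y ≤
    (prodBernoulli u).real (T ∩ Y) * (prodBernoulli u).real X at hdd
  have hTc : {ω : BondConfig (Fin n) | ∀ m ∈ W, ¬ (openGraph ω).Reachable i m} = Tᶜ := by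
    ext ω; simp only [hT, mem_setOf_eq, mem_compl_iff, not_exists, not_and]
  rw [hTc]
  set B := {ω : BondConfig (Fin n) | Mi ω ≤ j ∧ Ml ω ≤ j} with hB
  have hl_split : Tᶜ ∩ {ω | Ml ω ≤ j} = (Tᶜ ∩ Y) ∪ (Tᶜ ∩ B) := by
    ext ω; simp only [hY, hB, mem_inter_iff, mem_union, mem_setOf_eq, mem_compl_iff]
    constructor
    · rintro ⟨h1, h2⟩
      by_cases h : Mi ω ≤ j
      · exact Or.inr ⟨h1, h, h2⟩
      · exact Or.inl ⟨h1, h2, by omega⟩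
    · rintro (⟨h1, h2, _⟩ | ⟨h1, _, h2⟩) <;> exact ⟨h1, h2⟩
  have hi_split : Tᶜ ∩ {ω | Mi ω ≤ j} = (Tᶜ ∩ X) ∪ (Tᶜ ∩ B) := by
    ext ω; simp only [hX, hB, mem_inter_iff, mem_union, mem_setOf_eq, mem_compl_iff]
    constructor
    · rintro ⟨h1, h2⟩
      by_cases h : Ml ω ≤ j
      · exact Or.inr ⟨h1, h2, h⟩
      · exact Or.inl ⟨h1, h2, by omega⟩
    · rintro (⟨h1, h2, _⟩ | ⟨h1, h2, _⟩) <;> exact ⟨h1, h2⟩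
  have hdisj_l : Disjoint (Tᶜ ∩ Y) (Tᶜ ∩ B) := by
    rw [Set.disjoint_left]
    rintro ω ⟨_, hY'⟩ ⟨_, hB'⟩
    simp only [hY, hB, mem_setOf_eq] at hY' hB'
    omega
  have hdisj_i : Disjoint (Tᶜ ∩ X) (Tᶜ ∩ B) := by
    rw [Set.disjoint_left]
    rintro ω ⟨_, hX'⟩ ⟨_, hB'⟩
    simp only [hX, hB, mem_setOf_eq] at hX' hB'
    omega
  show (prodBernoulli u).real (Tᶜ ∩ {ω | Ml ω ≤ j}) ≤ (prodBernoulli u).real (Tᶜ ∩ {ω | Mi ω ≤ j})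
  rw [hl_split, hi_split, measureReal_union hdisj_l MeasurableSet.of_discrete,
    measureReal_union hdisj_i MeasurableSet.of_discrete]
  have hXB : Disjoint X B := by
    rw [Set.disjoint_left]; rintro ω hX' hB'; simp only [hX, hB, mem_setOf_eq] at hX' hB'; omega
  have hYB : Disjoint Y B := by
    rw [Set.disjoint_left]; rintro ω hY' hB'; simp only [hY, hB, mem_setOf_eq] at hY' hB'; omega
  have hsX : (prodBernoulli u).real {ω | Mi ω ≤ j} = (prodBernoulli u).real X + (prodBernoulli u).real B := by
    have : {ω : BondConfig (Fin n) | Mi ω ≤ j} = X ∪ B := by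
      ext ω; simp only [hX, hB, mem_union, mem_setOf_eq]
      constructor
      · intro h
        by_cases h' : Ml ω ≤ j
        · exact Or.inr ⟨h, h'⟩
        · exact Or.inl ⟨h, by omega⟩
      · rintro (⟨h, _⟩ | ⟨h, _⟩) <;> exact h
    rw [this, measureReal_union hXB MeasurableSet.of_discrete]
  have hsY : (prodBernoulli u).real {ω | Ml ω ≤ j} = (prodBernoulli u).real Y + (prodBernoulli u).real B := by
    have : {ω : BondConfig (Fin n) | Ml ω ≤ j} = Y ∪ B := by
      ext ω; simp only [hY, hB, mem_union, mem_setOf_eq]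
      constructor
      · intro h
        by_cases h' : Mi ω ≤ j
        · exact Or.inr ⟨h', h⟩
        · exact Or.inl ⟨h, by omega⟩
      · rintro (⟨h, _⟩ | ⟨_, h⟩) <;> exact h
    rw [this, measureReal_union hYB MeasurableSet.of_discrete]
  have hXY : (prodBernoulli u).real Y ≤ (prodBernoulli u).real X := by
    have h := hs
    change (prodBernoulli u).real {ω | Ml ω ≤ j} ≤ (prodBernoulli u).real {ω | Mi ω ≤ j} at h
    rw [hsX, hsY] at h
    linarith
  have hcX : (prodBernoulli u).real (Tᶜ ∩ X) = (prodBernoulli u).real X - (prodBernoulli u).real (T ∩ X) := by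
    have h1 := measureReal_inter_add_sdiff (μ := prodBernoulli u) (s := X)
      (MeasurableSet.of_discrete (s := T)) (measure_ne_top _ _)
    have h2 : X \ T = Tᶜ ∩ X := by ext ω; simp only [mem_sdiff, mem_inter_iff, mem_compl_iff]; tauto
    have h3 : X ∩ T = T ∩ X := inter_comm _ _
    rw [h2, h3] at h1
    linarith
  have hcY : (prodBernoulli u).real (Tᶜ ∩ Y) = (prodBernoulli u).real Y - (prodBernoulli u).real (T ∩ Y) := by
    have h1 := measureReal_inter_add_sdiff (μ := prodBernoulli u) (s := Y)
      (MeasurableSet.of_discrete (s := T)) (measure_ne_top _ _)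
    have h2 : Y \ T = Tᶜ ∩ Y := by ext ω; simp only [mem_sdiff, mem_inter_iff, mem_compl_iff]; tauto
    have h3 : Y ∩ T = T ∩ Y := inter_comm _ _
    rw [h2, h3] at h1
    linarith
  rw [hcX, hcY]
  have hTX_le : (prodBernoulli u).real (T ∩ X) ≤ (prodBernoulli u).real X :=
    measureReal_mono inter_subset_right (measure_ne_top _ _)
  have hTY_le : (prodBernoulli u).real (T ∩ Y) ≤ (prodBernoulli u).real Y :=
    measureReal_mono inter_subset_right (measure_ne_top _ _)
  have hTY0 : 0 ≤ (prodBernoulli u).real (T ∩ Y) := measureReal_nonneg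
  have hTX0 : 0 ≤ (prodBernoulli u).real (T ∩ X) := measureReal_nonneg
  have hY0 : 0 ≤ (prodBernoulli u).real Y := measureReal_nonneg
  have main : (prodBernoulli u).real Y - (prodBernoulli u).real (T ∩ Y) ≤
      (prodBernoulli u).real X - (prodBernoulli u).real (T ∩ X) := by
    by_cases hX0 : (prodBernoulli u).real X = 0
    · have hY0' : (prodBernoulli u).real Y = 0 := le_antisymm (hX0 ▸ hXY) hY0
      have h1 : (prodBernoulli u).real (T ∩ X) = 0 := le_antisymm (hX0 ▸ hTX_le) hTX0
      have h2 : (prodBernoulli u).real (T ∩ Y) = 0 := le_antisymm (hY0' ▸ hTY_le) hTY0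
      rw [hX0, hY0', h1, h2]
    · have hXpos : 0 < (prodBernoulli u).real X := lt_of_le_of_ne measureReal_nonneg (Ne.symm hX0)
      have k1 : (prodBernoulli u).real X * ((prodBernoulli u).real Y - (prodBernoulli u).real (T ∩ Y)) ≤
          (prodBernoulli u).real X * (prodBernoulli u).real Y -
            (prodBernoulli u).real Y * (prodBernoulli u).real (T ∩ X) := by nlinarith
      have k2 : (prodBernoulli u).real X * (prodBernoulli u).real Y -
            (prodBernoulli u).real Y * (prodBernoulli u).real (T ∩ X) ≤
          (prodBernoulli u).real X * ((prodBernoulli u).real X - (prodBernoulli u).real (T ∩ X)) := by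
        nlinarith
      exact le_of_mul_le_mul_left (k1.trans k2) hXpos
  linarith

end CutObserver

end Summit.CriticalPhenomena.PercolationContinuityZ3.Theorems

end
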